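import Summits.AnomalousDissipation.AnomalousDissipation.Theses.TameRoughRigidity
import HarnessLib

/-!
# Route TameRoughRigidity — the support item `RigiditySplit`

Proof of the route declaration
`Summit.AnomalousDissipation.AnomalousDissipation.Theses.TameRoughRigidity.RigiditySplit`
(item stmt-AnomalousDissipation-18403): the typed split
`GPEulerCoercive → TameClosure → TameToRough → GPStatisticalRigidity`, i.e. N → K → R → X for the
pinned force `f_GP = sin(2πx₂)e₀ + sin(2πx₀)e₁ + sin(2πx₁)e₂` on `T³`:

* N (`GPEulerCoercive`): `f_GP` carries no stationary statistical solution of the forced Euler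
  equations in the Foias–Manley–Rosa–Temam class;
* K (`TameClosure`): at every energy level `E` and mean-enstrophy level `G₁`, tame near-statistics
  with arbitrarily small cylindrical forced-Euler defect close up to an exact Euler statistics;
* R (`TameToRough`): if every tame class carries a defect gap, then above a roughness threshold
  `G₁(E)` admissible near-statistics with defect `≤ R ≤ δ₀` pay `c ≤ R · √G`;
* X (`GPStatisticalRigidity`): the route-local (byte-identical) copy of the parent leaf
  `EnsembleRigidity.GPStatisticalRigidity`.

The argument is pure glue between these route-local propositions (≈ 25 tactic lines), the same as
the `have hX` block of the route's deciding theorem `TameRoughRigidity.closes`: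
(1) N + K give, by contraposition, a defect gap `r(E, G₁) > 0` on every tame class;
(2) R turns the gap into the calibration on the rough class, with its own threshold `G₁(E)`;
(3) patch at `G₁(E)` with `δ₀' = min δ₀ (r/2)`, `r = r(E, G₁(E))`: at or above the threshold the
conclusion is R's; below it the measure is tame, and a defect bound `≤ R ≤ r/2 < r` contradicts the
gap, so that case is vacuous.

## References

* C. Foias, O. Manley, R. Rosa, R. Temam, *Navier–Stokes Equations and Turbulence* (CUP 2001),
  Ch. IV §1.2 Def. 1.3 (stationary statistical solutions). [FoiasManleyRosaTemam2001]
-/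

-- `Summit.<Summit>.<Problem>` is the tree's mandated summit-side namespace (CONVENTIONS §2); for
-- this single-conjunct summit the two coincide, so the duplicate is deliberate.
set_option linter.dupNamespace false

namespace Summit.AnomalousDissipation.AnomalousDissipation.Theorems.TameRoughRigidity

open Summit.AnomalousDissipation.AnomalousDissipation.Theses.TameRoughRigidity

/-- **The typed split N → K → R → X** — the route declaration `TameRoughRigidity.RigiditySplit`
(item stmt-AnomalousDissipation-18403): `GPEulerCoercive → TameClosure → TameToRough →
GPStatisticalRigidity`. Euler-coercivity of `f_GP` (N) and tame closure (K) give a positive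
cylindrical defect gap on every tame class `(E, G₁)`; the conditional Onsager calibration (R) turns
that gap into `c ≤ R · √(ensembleEnstrophy μ)` above its threshold `G₁(E)`; with
`δ₀' = min δ₀ (r(E, G₁(E)) / 2)` the tame case below the threshold is vacuous (defect `≤ r/2`
contradicts the gap `r`), which patches the two regimes into statistical Lamb rigidity of `f_GP`
at every energy level. [folklore] -/
theorem rigiditySplit_proof :
    Summit.AnomalousDissipation.AnomalousDissipation.Theses.TameRoughRigidity.RigiditySplit := by
  unfold Summit.AnomalousDissipation.AnomalousDissipation.Theses.TameRoughRigidity.RigiditySplit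
  intro h₁ h₂ h₃ f hf E
  -- (1) N + K ⇒ a DEFECT GAP on every tame class (E', G₁): contraposition of the closure lemma
  have gap : ∀ E G₁ : ℝ, ∃ r : ℝ, 0 < r ∧
      ∀ μ : MeasureTheory.Measure (Literature.Analysis.FunctionSpaces.Torus.energySpace (Fin 3)),
        MeasureTheory.IsProbabilityMeasure μ →
        MeasureTheory.Integrable
          (fun v : Literature.Analysis.FunctionSpaces.Torus.energySpace (Fin 3) => ‖v‖ ^ 2) μ →
        Literature.Analysis.FluidPDE.Torus.ensembleEnergy μ ≤ E →
        Literature.Analysis.FluidPDE.Torus.ensembleEnstrophy μ ≤ ENNReal.ofReal G₁ →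
        ¬ (∀ Φ : Literature.Analysis.FluidPDE.Torus.CylindricalTest (Fin 3),
            MeasureTheory.Integrable
              (fun v : Literature.Analysis.FunctionSpaces.Torus.energySpace (Fin 3) =>
                Literature.Analysis.FluidPDE.Torus.nsGeneratorPairing 0 f v (Φ.grad v)) μ ∧
            |∫ v, Literature.Analysis.FluidPDE.Torus.nsGeneratorPairing 0 f v (Φ.grad v) ∂μ| ≤
              r * Real.sqrt
                (∫ v, Literature.Analysis.FunctionSpaces.Torus.gradNormSq (Φ.grad v) ∂μ)) := by
    intro E' G₁
    by_contra hcon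
    push Not at hcon
    obtain ⟨μ, hμ, -⟩ := h₂ f hf E' G₁ hcon
    exact h₁ f hf μ hμ
  -- (2) R turns the gap into the Onsager calibration on the rough class, with its own threshold
  obtain ⟨G₁, c, δ₀, hc, hδ₀, hrough⟩ := h₃ f hf gap E
  -- (3) patch at G₁(E) with δ₀' = min δ₀ (r/2): below G₁ the gap r makes the defect hypothesis
  --     impossible (vacuity); at or above G₁ the calibration is R's conclusion
  obtain ⟨r, hr, hgap⟩ := gap E G₁
  refine ⟨c, min δ₀ (r / 2), hc, lt_min hδ₀ (by linarith), ?_⟩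
  intro μ hprob hint hE hfin hshell R hR0 hRle hdef
  by_cases hcase : ENNReal.ofReal G₁ ≤ Literature.Analysis.FluidPDE.Torus.ensembleEnstrophy μ
  · exact hrough μ hprob hint hE hfin hcase hshell R hR0 (hRle.trans (min_le_left _ _)) hdef
  · exfalso
    have htame : Literature.Analysis.FluidPDE.Torus.ensembleEnstrophy μ ≤ ENNReal.ofReal G₁ :=
      (not_le.mp hcase).le
    refine hgap μ hprob hint hE htame ?_
    intro Φ
    obtain ⟨hi, hb⟩ := hdef Φ
    refine ⟨hi, hb.trans ?_⟩
    have hRr : R ≤ r := hRle.trans ((min_le_right _ _).trans (by linarith))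
    exact mul_le_mul_of_nonneg_right hRr (Real.sqrt_nonneg _)

end Summit.AnomalousDissipation.AnomalousDissipation.Theorems.TameRoughRigidity
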